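import Summits.CriticalPhenomena.PercolationContinuityZ3.Theorems.Transplant.FKConnectivityAllQForestStarDescentFar
import Mathlib.Algebra.Order.BigOperators.Group.Finset
import HarnessLib

/-!
# STAR DESCENT, existential form: ONE good non-neighbour per stage suffices (and hence the AVERAGED red-join inequality suffices)

Support file (`--supports stmt-CriticalPhenomena-4575`), FK sub-lane `prim-bschramm-fk-1` (gen 28) of the post-continuity programme;
builds on p205010 (kernel theorem, internal audit signed; external expert review pending).  No definitions, no named facts, no sorries;
standard axioms.

`…ForestStarDescentFar` proves `adjForestNoSq_top_of_redJoinFar`: if the red-join inequality (RJ)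
`#(Fo∩{e,f}∩R_os, Fo) + #(Fo∩R_os, Fo∩{e,f}) ≤ #(Fo∩{e}∩R_os, Fo∩{f}) + #(Fo∩{f}∩R_os, Fo∩{e})` (graph language: `Σ χ(e,f)[s ∈ C_A(o)] ≥ 0`)
holds at EVERY non-neighbour `s` of `o` on every top fibre, then the square-free adjacent forest Rayleigh inequality (the node (♣)⁰,
`AdjForestRayleighNoSqOn`) holds on every top fibre.  The induction there adds the missing star pairs `os` one at a time in an ARBITRARY order,
so it only ever needs ONE good vertex per stage.  THIS FILE records the two weaker sufficient hypotheses this observation yields: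
* **`adjForestNoSq_top_of_exists_redJoin`** — if for every top fibre `(E, ∅)` through `ov, oy` in which `o` still has a non-neighbour there is
  SOME non-neighbour `s ≠ o` of `o` at which (RJ) holds, then the node holds on every top fibre (same descent from the cone, g22's
  `adjForestNoSq_top_of_universal` at the base, `adjForestNoSq_fibre_of_insert_star` at the step);
* **`adjForestNoSq_top_of_sum_redJoin`** — the AVERAGED form: it is enough that, on every such top fibre, the (RJ) inequality holds after SUMMING
  both sides over all non-neighbours `s` of `o` (graph language: `Σ_{(A,B)} χ(e,f)·|C_A(o) ∖ N[o]| ≥ 0`), by `Finset.exists_le_of_sum_le`.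
Evidence for the averaged form (fk-1 g28, exact, exhaustive; numerics lit28.c): 0 failures over all connected simple graphs with ≤ 7 vertices
(31,412,115 instances `(G, o, e, f)` at `n = 7`, `m ≤ 12`) and 500 random (multi)graphs with 8–11 vertices; it is implied by (RJ-far) and is
strictly weaker as a hypothesis.  Memo bschramm/FROM-fk-1-g28-TRACE-CONE.md.
[cite: SempleWelsh2008, Conj. 1.1 (p. 2); Thm. 4.2 (p. 11)] [cite: Linusson2011, Prop. 2.6] [cite: Grimmett2006, §1.5 (p. 13)]
-/

noncomputable section

namespace Summit.CriticalPhenomena.PercolationContinuityZ3.Theorems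
namespace FK

open MeasureTheory Set Literature.Probability.LatticeModels Literature.Probability.Percolation
open scoped Classical symmDiff

variable {V : Type*} [Fintype V]

section Exists

/-- **EXISTENTIAL STAR DESCENT**: if on every top fibre `(E, ∅)` through `ov, oy` (`v ≠ y`) in which `o` has a non-neighbour there is SOME
non-neighbour `s ≠ o` (`s(o,s) ∉ E`) at which the red-join inequality (RJ) holds, then the node's inequality holds on every top fibre.
[cite: SempleWelsh2008, Conj. 1.1 (p. 2); Thm. 4.2 (p. 11)] [cite: Linusson2011, Prop. 2.6] [cite: Grimmett2006, §1.5 (p. 13)] -/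
theorem adjForestNoSq_top_of_exists_redJoin (o : V) {v y : V} (hvy : v ≠ y)
    (h : ∀ E : BondConfig V, s(o, v) ∈ E → s(o, y) ∈ E → (∃ w, w ≠ o ∧ s(o, w) ∉ E) →
      ∃ s, s ≠ o ∧ s(o, s) ∉ E ∧
        (fibreCount E ∅ (forestEv V ∩ {ω | s(o, v) ∈ ω ∧ s(o, y) ∈ ω} ∩ reachEv o s) (forestEv V) +
            fibreCount E ∅ (forestEv V ∩ reachEv o s) (forestEv V ∩ {ω | s(o, v) ∈ ω ∧ s(o, y) ∈ ω}) ≤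
          fibreCount E ∅ (forestEv V ∩ {ω | s(o, v) ∈ ω} ∩ reachEv o s) (forestEv V ∩ {ω | s(o, y) ∈ ω}) +
            fibreCount E ∅ (forestEv V ∩ {ω | s(o, y) ∈ ω} ∩ reachEv o s) (forestEv V ∩ {ω | s(o, v) ∈ ω})))
    (Eg : BondConfig V) :
    fibreCount Eg ∅ (forestEv V ∩ {ω | s(o, v) ∈ ω ∧ s(o, y) ∈ ω}) (forestEv V) ≤
      fibreCount Eg ∅ (forestEv V ∩ {ω | s(o, v) ∈ ω}) (forestEv V ∩ {ω | s(o, y) ∈ ω}) := by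
  -- degenerate placements
  by_cases hov : o = v
  · subst hov
    rw [fibreCount_eq_zero_of_forall _ _ _ _ fun ω _ hA _ => hA.1.1 _ hA.2.1 (Sym2.mk_isDiag_iff.2 rfl)]
    exact Nat.zero_le _
  by_cases hoy : o = y
  · subst hoy
    rw [fibreCount_eq_zero_of_forall _ _ _ _ fun ω _ hA _ => hA.1.1 _ hA.2.2 (Sym2.mk_isDiag_iff.2 rfl)]
    exact Nat.zero_le _
  by_cases he : s(o, v) ∈ Eg
  swap
  · rw [adjForestNoSq_bad_eq_zero_of_notMem he (notMem_empty _)]; exact Nat.zero_le _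
  by_cases hf : s(o, y) ∈ Eg
  swap
  · rw [adjForestNoSq_bad_eq_zero_of_notMem' hf (notMem_empty _)]; exact Nat.zero_le _
  -- induction on the number of non-neighbours of `o`
  suffices H : ∀ (k : ℕ) (E : BondConfig V), s(o, v) ∈ E → s(o, y) ∈ E →
      ({w : V | w ≠ o ∧ s(o, w) ∉ E} : Set V).ncard = k →
      fibreCount E ∅ (forestEv V ∩ {ω | s(o, v) ∈ ω ∧ s(o, y) ∈ ω}) (forestEv V) ≤
        fibreCount E ∅ (forestEv V ∩ {ω | s(o, v) ∈ ω}) (forestEv V ∩ {ω | s(o, y) ∈ ω}) from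
    H _ Eg he hf rfl
  intro k
  induction k with
  | zero =>
    intro E heE hfE hk
    refine adjForestNoSq_top_of_universal (fun w hw => ?_) hvy hov hoy
    by_contra hnot
    have hmem : w ∈ ({w : V | w ≠ o ∧ s(o, w) ∉ E} : Set V) := ⟨hw, hnot⟩
    rw [(Set.ncard_eq_zero (Set.toFinite _)).1 hk] at hmem
    exact hmem
  | succ k ih =>
    intro E heE hfE hk
    obtain ⟨w, hwo, hwE⟩ : ({w : V | w ≠ o ∧ s(o, w) ∉ E} : Set V).Nonempty :=
      Set.nonempty_of_ncard_ne_zero (by rw [hk]; exact Nat.succ_ne_zero k)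
    obtain ⟨s, hso, hsE, hRJ⟩ := h E heE hfE ⟨w, hwo, hwE⟩
    have hsv : s ≠ v := fun h' => hsE (h' ▸ heE)
    have hsy : s ≠ y := fun h' => hsE (h' ▸ hfE)
    have hcard : ({w : V | w ≠ o ∧ s(o, w) ∉ insert s(o, s) E} : Set V).ncard = k := by
      have hsub : ({w : V | w ≠ o ∧ s(o, w) ∉ insert s(o, s) E} : Set V) = {w : V | w ≠ o ∧ s(o, w) ∉ E} \ {s} := by
        ext w'
        simp only [mem_setOf_eq, mem_sdiff, mem_singleton_iff, mem_insert_iff, not_or]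
        constructor
        · rintro ⟨hwo', hws, hwE'⟩
          exact ⟨⟨hwo', hwE'⟩, fun hws' => hws (by rw [hws'])⟩
        · rintro ⟨⟨hwo', hwE'⟩, hws⟩
          exact ⟨hwo', fun h' => hws (Sym2.congr_right.1 h'), hwE'⟩
      rw [hsub, Set.ncard_sdiff_singleton_of_mem (show s ∈ ({w : V | w ≠ o ∧ s(o, w) ∉ E} : Set V) from ⟨hso, hsE⟩), hk]
      rfl
    have hup := ih (insert s(o, s) E) (mem_insert_of_mem _ heE) (mem_insert_of_mem _ hfE) hcard
    exact adjForestNoSq_fibre_of_insert_star hso.symm hsv hsy hsE (notMem_empty _) hRJ hup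

/-- **AVERAGED STAR DESCENT**: if on every top fibre `(E, ∅)` through `ov, oy` the (RJ) inequality holds after summing both sides over the
non-neighbours `s ≠ o` of `o` (whenever there is one) — in graph language `Σ_{(A,B)} χ(e,f)·|C_A(o) ∖ N[o]| ≥ 0` — then the node's
inequality holds on every top fibre: some summand must satisfy (RJ) (`Finset.exists_le_of_sum_le`), and the existential descent applies.
[cite: SempleWelsh2008, Conj. 1.1 (p. 2); Thm. 4.2 (p. 11)] [cite: Linusson2011, Prop. 2.6] [cite: Grimmett2006, §1.5 (p. 13)] -/
theorem adjForestNoSq_top_of_sum_redJoin (o : V) {v y : V} (hvy : v ≠ y)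
    (h : ∀ E : BondConfig V, s(o, v) ∈ E → s(o, y) ∈ E → (∃ w, w ≠ o ∧ s(o, w) ∉ E) →
      ∑ s ∈ Finset.univ.filter (fun s : V => s ≠ o ∧ s(o, s) ∉ E),
          (fibreCount E ∅ (forestEv V ∩ {ω | s(o, v) ∈ ω ∧ s(o, y) ∈ ω} ∩ reachEv o s) (forestEv V) +
            fibreCount E ∅ (forestEv V ∩ reachEv o s) (forestEv V ∩ {ω | s(o, v) ∈ ω ∧ s(o, y) ∈ ω})) ≤
        ∑ s ∈ Finset.univ.filter (fun s : V => s ≠ o ∧ s(o, s) ∉ E),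
          (fibreCount E ∅ (forestEv V ∩ {ω | s(o, v) ∈ ω} ∩ reachEv o s) (forestEv V ∩ {ω | s(o, y) ∈ ω}) +
            fibreCount E ∅ (forestEv V ∩ {ω | s(o, y) ∈ ω} ∩ reachEv o s) (forestEv V ∩ {ω | s(o, v) ∈ ω})))
    (Eg : BondConfig V) :
    fibreCount Eg ∅ (forestEv V ∩ {ω | s(o, v) ∈ ω ∧ s(o, y) ∈ ω}) (forestEv V) ≤
      fibreCount Eg ∅ (forestEv V ∩ {ω | s(o, v) ∈ ω}) (forestEv V ∩ {ω | s(o, y) ∈ ω}) := by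
  refine adjForestNoSq_top_of_exists_redJoin o hvy (fun E heE hfE hne => ?_) Eg
  obtain ⟨w, hwo, hwE⟩ := hne
  have hwmem : w ∈ Finset.univ.filter (fun s : V => s ≠ o ∧ s(o, s) ∉ E) := by
    simp only [Finset.mem_filter, Finset.mem_univ, true_and]; exact ⟨hwo, hwE⟩
  obtain ⟨s, hs, hle⟩ := Finset.exists_le_of_sum_le ⟨w, hwmem⟩ (h E heE hfE ⟨w, hwo, hwE⟩)
  simp only [Finset.mem_filter, Finset.mem_univ, true_and] at hs
  exact ⟨s, hs.1, hs.2, hle⟩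

end Exists

end FK
end Summit.CriticalPhenomena.PercolationContinuityZ3.Theorems

end
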